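/-
Copyright (c) 2026. All rights reserved.
Released under Apache 2.0 license as described in the file LICENSE.
Authors: abc-iut cell, seat abc-iut-f-069 (gen 9; row «PL2-FOX», file 3 of 3).
-/
import Literature.AnabelianGeometry.EtaleTheta.SettingModelFoxLevelMaps
import HarnessLib

/-!
# The level Fox homomorphisms, II: `Ẑ`-powers, change of level and coefficients, and the torus chain rule

Mochizuki, *The étale theta function …*, Publ. RIMS **45** (2009) [EtTh], §1, PRIMS PDF p. 12
[cite: MochizukiEtTh2009, §1 p.12] ("`Δ_X` … a profinite free group on 2 generators"; the model `F̂₂` with its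
`Ẑ`-powers `powHat`, `b^Ẑ = bPow`, and the twists `θ_u : a ↦ a, b ↦ b^u` = `twistEnd u` / `twist φ` of
`SettingModelChiTwist` (abc-iut-w5-d024)).  Classical tool: Fox calculus read in a finite quotient (Lyndon–Schupp,
*Combinatorial Group Theory*, Ch. II §3) [cite: LyndonSchupp2001, Ch. II §3], via abc-iut-f-069's `FoxChain.W`,
`FoxChain.mapW`/`push` (levels), `FoxChain.mapK` (coefficients), `FoxChain.torHom` (the torus operator).

PROOF-ONLY file (no definition, no instance, no notation), abc-iut-f-069 (gen 9), PROGRAMME P-L2 rung (L2-T) first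
slice, file 3 of 3, over `SettingModelFoxLevelMaps.lean` (`lev`, `fox`, `alpha`, `beta`):
* §1 (c3) `Ẑ`-POWERS: `fox_powHat` (`ψ(x^u) = ψ(x)^{(u mod E)}`, `E` any exponent of `W G k`), `lev_powHat`,
  `alpha_powHat_of_lev_eq_one` (`α_{h^u} = (u mod E) • α_h` on `Ker π`), `alpha_bPow` (`α(b^t) = 0`, HAVE
  `DehnTwist.fox_bPow_fst_eq_zero`), `beta_powHat_genA` (`β(a^s) = 0`), `fox_bPow`;
* §2 COMPATIBILITY of levels along `ρ : G' →* G` (`fox_eq_mapW_fox` = HAVE `DehnTwist.fox_eq_mapW`, `alpha_eq_push`,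
  `beta_eq_push`, `lev_eq_comp`) and of coefficients along `σ : k' →+* k` (`fox_eq_mapK_fox`, `alpha_eq_comp`,
  `beta_eq_comp`);
* §3 (c4) THE TORUS CHAIN RULE at a level where `B^n = 1`: for `u ∈ Ẑ` with `u ≡ 1 + nq (mod E)`,
  **`ψ ∘ θ_u = Tor_{B,n,q} ∘ ψ`** (`fox_twistEnd`; two continuous homomorphisms agreeing on `η a`, `η b`, the value on
  `η b` being the geometric series `∂(b^{1+nq})/∂b ↦ e_1 + q·N_B`, `FoxChain.torHom_wb_eq_pow`), its `ℕ`-form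
  `fox_twistEnd_natCast` (`u = ι(1+nq)`), its `Aut(Ẑ)`-form `fox_twist` (`θ_φ`, `q` read off the level-`E` cyclotomic
  character), the chain forms `alpha_twistEnd` (`α` unchanged), `beta_twistEnd` (`β ↦ β·(1 + q N_B)`), `lev_twistEnd`,
  and the `u ≡ 1 (mod n)` packaging `exists_fox_twistEnd_eq_torHom` (first half of row (Φ); the composition law
  `Tor_q ∘ Tor_{q'} = Tor_{q+q'+nqq'}` and `Tor ∘ inr = inr` are `FoxChain.torHom_comp` / `torHom_inr`).
The general discrete Fox chain rule for endomorphisms of `F(a,b)` (PL2-SIZING (F1′)) is made unnecessary by the level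
form and is not typed.  Model-free classical profinite group theory (nothing about `hextΔ`/`hΘ` is stated or imported);
nothing of [EtTh] is asserted; no side is taken on [IUTchIII] Cor. 3.12.
-/

noncomputable section

namespace Literature.AnabelianGeometry.EtaleTheta.SettingModel.FoxLevel

open Literature.GroupTheory.CombinatorialGroupTheory.FoxChain
open Literature.AnabelianGeometry.AbsoluteAnabelian.AbsTopII
open CategoryTheory

variable {G : Type} [Group G] [Finite G] [DecidableEq G] {k : Type} [CommRing k] [Finite k]

omit [DecidableEq G] in
/-- `W G k` has an exponent (it is a finite group). [folklore] -/
private theorem exists_exponent : ∃ E : ℕ+, ∀ w : W G k, w ^ (E : ℕ) = 1 := by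
  haveI : Finite (W G k) := DehnTwist.finite_W
  exact ⟨⟨Monoid.exponent (W G k), Monoid.ExponentExists.of_finite.exponent_pos⟩,
    fun w => Monoid.pow_exponent_eq_one w⟩

/-! ### (c3) `Ẑ`-powers -/

/-- **`ψ (x^u) = ψ(x)^{(u mod E)}`** for `u ∈ Ẑ` and any exponent `E` of `W G k` (`SettingModel.apply_powHat_eq_pow`).
[cite: MochizukiEtTh2009, §1 p.12] -/
theorem fox_powHat (A B : G) (E : ℕ+) (hE : ∀ w : W G k, w ^ (E : ℕ) = 1) (x : F₂hatT) (u : ZH) :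
    fox (k := k) A B (powHat x u) = fox A B x ^ (Multiplicative.toAdd (ZHatLevel.level E u)).val := by
  letI : TopologicalSpace (W G k) := ⊥
  haveI : DiscreteTopology (W G k) := ⟨rfl⟩
  exact apply_powHat_eq_pow (foxC A B) E hE x u

omit [DecidableEq G] in
/-- `π (x^u) = π(x)^{(u mod E)}` for any `E` killing `G`. [cite: MochizukiEtTh2009, §1 p.12] -/
theorem lev_powHat (A B : G) (E : ℕ+) (hE : ∀ g : G, g ^ (E : ℕ) = 1) (x : F₂hatT) (u : ZH) :
    lev A B (powHat x u) = lev A B x ^ (Multiplicative.toAdd (ZHatLevel.level E u)).val := by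
  letI : TopologicalSpace G := ⊥
  haveI : DiscreteTopology G := ⟨rfl⟩
  exact apply_powHat_eq_pow (levC A B) E hE x u

/-- **(c3) profinite powers on `Ker π`**: `α_{h^u} = (u mod E) • α_h` for `π h = 1`, `u ∈ Ẑ`, `E` any exponent of
`W G k` (continuity in `u`: `ψ ∘ h^·` factors through `ℤ/E`). [cite: LyndonSchupp2001, Ch. II §3] -/
theorem alpha_powHat_of_lev_eq_one (A B : G) (E : ℕ+) (hE : ∀ w : W G k, w ^ (E : ℕ) = 1) {h : F₂hatT}
    (hh : lev A B h = 1) (u : ZH) :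
    alpha (k := k) A B (powHat h u) = (Multiplicative.toAdd (ZHatLevel.level E u)).val • alpha A B h := by
  rw [alpha_def, fox_powHat A B E hE, fst_left_pow_of_right_eq_one (by rw [fox_right, hh])]; rfl

/-- (c3) profinite powers on `Ker π`, `β`. [cite: LyndonSchupp2001, Ch. II §3] -/
theorem beta_powHat_of_lev_eq_one (A B : G) (E : ℕ+) (hE : ∀ w : W G k, w ^ (E : ℕ) = 1) {h : F₂hatT}
    (hh : lev A B h = 1) (u : ZH) :
    beta (k := k) A B (powHat h u) = (Multiplicative.toAdd (ZHatLevel.level E u)).val • beta A B h := by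
  rw [beta_def, fox_powHat A B E hE, snd_left_pow_of_right_eq_one (by rw [fox_right, hh])]; rfl

/-- `Ẑ`-powers of an element with zero `a`-chain have zero `a`-chain. [cite: LyndonSchupp2001, Ch. II §3] -/
theorem alpha_powHat_of_alpha_eq_zero (A B : G) {x : F₂hatT} (hx : alpha (k := k) A B x = 0) (u : ZH) :
    alpha (k := k) A B (powHat x u) = 0 := by
  obtain ⟨E, hE⟩ := exists_exponent (G := G) (k := k)
  rw [alpha_def, fox_powHat A B E hE, fst_left_pow, ← alpha_def, hx]
  simp only [lt_zero, Finset.sum_const_zero]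

/-- `Ẑ`-powers of an element with zero `b`-chain have zero `b`-chain. [cite: LyndonSchupp2001, Ch. II §3] -/
theorem beta_powHat_of_beta_eq_zero (A B : G) {x : F₂hatT} (hx : beta (k := k) A B x = 0) (u : ZH) :
    beta (k := k) A B (powHat x u) = 0 := by
  obtain ⟨E, hE⟩ := exists_exponent (G := G) (k := k)
  rw [beta_def, fox_powHat A B E hE, snd_left_pow, ← beta_def, hx]
  simp only [lt_zero, Finset.sum_const_zero]

/-- **(c3) `α(b^t) = 0`** for all `t ∈ Ẑ` (`DehnTwist.fox_bPow_fst_eq_zero`). [cite: LyndonSchupp2001, Ch. II §3] -/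
theorem alpha_bPow (A B : G) (t : ZH) : alpha (k := k) A B (bPow t) = 0 := by
  letI : TopologicalSpace (W G k) := ⊥
  haveI : DiscreteTopology (W G k) := ⟨rfl⟩
  exact DehnTwist.fox_bPow_fst_eq_zero (Φ := foxC A B) (fox_genB A B) t

/-- **(c3) `β(a^s) = 0`** for all `s ∈ Ẑ` (the `a ↔ b` mirror; `a^s = powHat (η a) s`). [cite: LyndonSchupp2001, Ch. II §3] -/
theorem beta_powHat_genA (A B : G) (s : ZH) : beta (k := k) A B (powHat (eta (FreeGroup.of 0)) s) = 0 :=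
  beta_powHat_of_beta_eq_zero A B (beta_genA A B) s

/-- `α(b^t) = 0` in the `powHat` spelling. [cite: LyndonSchupp2001, Ch. II §3] -/
theorem alpha_powHat_genB (A B : G) (t : ZH) : alpha (k := k) A B (powHat (eta (FreeGroup.of 1)) t) = 0 :=
  alpha_powHat_of_alpha_eq_zero A B (alpha_genB A B) t

/-- `ψ (b^t) = (wb B)^{(t mod E)}` (`DehnTwist.fox_bPow_eq_pow`). [cite: LyndonSchupp2001, Ch. II §3] -/
theorem fox_bPow (A B : G) (E : ℕ+) (hE : ∀ w : W G k, w ^ (E : ℕ) = 1) (t : ZH) :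
    fox (k := k) A B (bPow t) = wb B ^ (Multiplicative.toAdd (ZHatLevel.level E t)).val := by
  rw [bPow_eq_powHat, fox_powHat A B E hE, fox_genB]

/-! ### Compatibility of levels and of coefficients -/

set_option maxHeartbeats 400000 in
/-- **Compatibility of levels**: along `ρ : G' →* G` with `ρ A' = A`, `ρ B' = B`, `ψ_{G} = mapW ρ ∘ ψ_{G'}`
(`DehnTwist.fox_eq_mapW`). [cite: LyndonSchupp2001, Ch. II §3] -/
theorem fox_eq_mapW_fox (A B : G) {G' : Type} [Group G'] [Fintype G'] [DecidableEq G'] (A' B' : G')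
    (ρ : G' →* G) (ha : ρ A' = A) (hb : ρ B' = B) (w : F₂hatT) :
    fox (k := k) A B w = mapW ρ (fox A' B' w) := by
  letI : TopologicalSpace (W G k) := ⊥
  haveI : DiscreteTopology (W G k) := ⟨rfl⟩
  letI : TopologicalSpace (W G' k) := ⊥
  haveI : DiscreteTopology (W G' k) := ⟨rfl⟩
  exact DehnTwist.fox_eq_mapW (Φ := foxC A B) (Φ' := foxC A' B') (fox_genA A B) (fox_genB A B)
    (fox_genA A' B') (fox_genB A' B') ρ ha hb w

/-- Levels, `a`-chain: `α^{(G)}_w = ρ_* α^{(G')}_w`. [cite: LyndonSchupp2001, Ch. II §3] -/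
theorem alpha_eq_push (A B : G) {G' : Type} [Group G'] [Fintype G'] [DecidableEq G'] (A' B' : G')
    (ρ : G' →* G) (ha : ρ A' = A) (hb : ρ B' = B) (w : F₂hatT) :
    alpha (k := k) A B w = push ρ (alpha A' B' w) := by
  rw [alpha_def, fox_eq_mapW_fox A B A' B' ρ ha hb, toAdd_mapW_left]; rfl

/-- Levels, `b`-chain: `β^{(G)}_w = ρ_* β^{(G')}_w`. [cite: LyndonSchupp2001, Ch. II §3] -/
theorem beta_eq_push (A B : G) {G' : Type} [Group G'] [Fintype G'] [DecidableEq G'] (A' B' : G')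
    (ρ : G' →* G) (ha : ρ A' = A) (hb : ρ B' = B) (w : F₂hatT) :
    beta (k := k) A B w = push ρ (beta A' B' w) := by
  rw [beta_def, fox_eq_mapW_fox A B A' B' ρ ha hb, toAdd_mapW_left]; rfl

omit [DecidableEq G] in
/-- Levels, `G`-component: `π_{G} = ρ ∘ π_{G'}`. [cite: MochizukiEtTh2009, §1 p.12] -/
theorem lev_eq_comp {G' : Type} [Group G'] [Finite G'] (A B : G) (A' B' : G') (ρ : G' →* G) (ha : ρ A' = A)
    (hb : ρ B' = B) : lev A B = ρ.comp (lev A' B') :=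
  (eq_lev_of_isOpen_ker A B (ρ.comp (lev A' B'))
    (by rw [MonoidHom.coe_ker]; exact isLocallyConstant_lev A' B' (ρ ⁻¹' {1}))
    (by rw [MonoidHom.comp_apply, lev_genA, ha]) (by rw [MonoidHom.comp_apply, lev_genB, hb])).symm

/-- **Compatibility of coefficients**: along `σ : k' →+* k` (e.g. `ℤ/M' → ℤ/M` for `M ∣ M'`),
`ψ_{k} = mapK σ ∘ ψ_{k'}`. [cite: LyndonSchupp2001, Ch. II §3] -/
theorem fox_eq_mapK_fox (A B : G) {k' : Type} [CommRing k'] [Finite k'] (σ : k' →+* k) (w : F₂hatT) :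
    fox (k := k) A B w = mapK σ (fox (k := k') A B w) := by
  have h := eq_fox_of_isOpen_ker A B ((mapK σ).comp (fox (k := k') A B))
    (by rw [MonoidHom.coe_ker]; exact isLocallyConstant_fox A B (mapK σ ⁻¹' {1}))
    (by rw [MonoidHom.comp_apply, fox_genA, mapK_wa]) (by rw [MonoidHom.comp_apply, fox_genB, mapK_wb])
  exact (DFunLike.congr_fun h w).symm

/-- Coefficients, `a`-chain: `α^{(k)}_w = σ ∘ α^{(k')}_w`. [cite: LyndonSchupp2001, Ch. II §3] -/
theorem alpha_eq_comp (A B : G) {k' : Type} [CommRing k'] [Finite k'] (σ : k' →+* k) (w : F₂hatT) :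
    alpha (k := k) A B w = ⇑σ ∘ alpha (k := k') A B w := by
  rw [alpha_def, fox_eq_mapK_fox A B σ, toAdd_mapK_left]; rfl

/-- Coefficients, `b`-chain: `β^{(k)}_w = σ ∘ β^{(k')}_w`. [cite: LyndonSchupp2001, Ch. II §3] -/
theorem beta_eq_comp (A B : G) {k' : Type} [CommRing k'] [Finite k'] (σ : k' →+* k) (w : F₂hatT) :
    beta (k := k) A B w = ⇑σ ∘ beta (k := k') A B w := by
  rw [beta_def, fox_eq_mapK_fox A B σ, toAdd_mapK_left]; rfl


/-! ### (c4) The torus chain rule `ψ ∘ θ_u = Tor ∘ ψ` -/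

/-- **Core of (c4)**: if `B^n = 1` and `ψ(b^u) = (wb B)^{1+nq}`, then `ψ (θ_u x) = Tor_{B,n,q} (ψ x)` for all `x`
(two continuous homomorphisms `F̂₂ → W G k` agreeing on `η a` — `Tor` fixes `wa A` — and on `η b` —
`Tor_q (wb B) = (wb B)^{1+nq}`). [cite: LyndonSchupp2001, Ch. II §3] -/
theorem fox_twistEnd_of_fox_bPow (A B : G) {n : ℕ} (hB : B ^ n = 1) (q : ℕ) {u : ZH}
    (hu : fox (k := k) A B (bPow u) = wb B ^ (1 + n * q)) (x : F₂hatT) :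
    fox (k := k) A B (twistEnd u x) = torHom B n (q : k) (fox A B x) := by
  letI : TopologicalSpace (W G k) := ⊥
  haveI : DiscreteTopology (W G k) := ⟨rfl⟩
  let T : W G k →ₜ* W G k := ⟨torHom B n (q : k), continuous_of_discreteTopology⟩
  have h : (foxC A B).comp (twistEnd u) = T.comp (foxC A B) := by
    refine ext_of_eta ?_ ?_
    · show fox A B (twistEnd u (eta (FreeGroup.of 0))) = torHom B n (q : k) (fox A B (eta (FreeGroup.of 0)))
      rw [twistEnd_eta_of_zero, fox_genA, torHom_wa]
    · show fox A B (twistEnd u (eta (FreeGroup.of 1))) = torHom B n (q : k) (fox A B (eta (FreeGroup.of 1)))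
      rw [twistEnd_eta_of_one, hu, fox_genB, torHom_wb_eq_pow hB]
  exact DFunLike.congr_fun h x

/-- **(c4) the torus chain rule, `Ẑ`-form.** Let `B^n = 1`, `E` an exponent of `W G k`, and `u ∈ Ẑ` with
`u ≡ 1 + nq (mod E)`.  Then `ψ (θ_u x) = Tor_{B,n,q} (ψ x)`: the `a`-chain is unchanged and the `b`-chain is
multiplied on the right by `1 + q·N_B` (`∂(b^{u})/∂b = 1 + b + ⋯ ↦ e_1 + q N_B`). [cite: LyndonSchupp2001, Ch. II §3] -/
theorem fox_twistEnd (A B : G) {n : ℕ} (hB : B ^ n = 1) (E : ℕ+) (hE : ∀ w : W G k, w ^ (E : ℕ) = 1) (q : ℕ)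
    {u : ZH} (hu : Multiplicative.toAdd (ZHatLevel.level E u) = ((1 + n * q : ℕ) : ZMod E)) (x : F₂hatT) :
    fox (k := k) A B (twistEnd u x) = torHom B n (q : k) (fox A B x) := by
  refine fox_twistEnd_of_fox_bPow A B hB q ?_ x
  rw [fox_bPow A B E hE, hu, ZMod.val_natCast, ← pow_eq_pow_mod _ (hE _)]

/-- `level E (ι m) = m mod E`. [cite: MochizukiEtTh2009, §1 p.12] -/
theorem toAdd_level_iotaZ (E : ℕ+) (m : ℤ) :
    Multiplicative.toAdd (ZHatLevel.level E (iotaZ (Multiplicative.ofAdd m))) = (m : ZMod E) := by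
  show Multiplicative.toAdd (ZHatLevel.level E (ZHatLevel.eta m)) = _
  rw [ZHatLevel.level_eta, toAdd_ofAdd]

/-- **(c4), `ℕ`-form**: for the INTEGER `u' = 1 + nq`, `ψ (θ_{ι u'} x) = Tor_{B,n,q} (ψ x)` whenever `B^n = 1`.
[cite: LyndonSchupp2001, Ch. II §3] -/
theorem fox_twistEnd_natCast (A B : G) {n : ℕ} (hB : B ^ n = 1) (q : ℕ) (x : F₂hatT) :
    fox (k := k) A B (twistEnd (iotaZ (Multiplicative.ofAdd ((1 + n * q : ℕ) : ℤ))) x) =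
      torHom B n (q : k) (fox A B x) := by
  refine fox_twistEnd_of_fox_bPow A B hB q ?_ x
  rw [bPow_iotaZ, toAdd_ofAdd, map_zpow, fox_genB, zpow_natCast]

/-- **(c4), `Aut(Ẑ)`-form**: for `φ ∈ Aut(Ẑ) = Ẑ^×` with level-`E` cyclotomic character `χ_E(φ) = 1 + nq`,
`ψ (θ_φ x) = Tor_{B,n,q} (ψ x)` (`θ_φ = twist φ : a ↦ a, b ↦ b^{φ(1)}`). [cite: LyndonSchupp2001, Ch. II §3] -/
theorem fox_twist (A B : G) {n : ℕ} (hB : B ^ n = 1) (E : ℕ+) (hE : ∀ w : W G k, w ^ (E : ℕ) = 1) (q : ℕ)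
    (φ : MulAut ZH) (hφ : ZHatLevel.levelChar E φ = ((1 + n * q : ℕ) : ZMod E)) (x : F₂hatT) :
    fox (k := k) A B (twist φ x) = torHom B n (q : k) (fox A B x) := by
  rw [twist_apply]
  refine fox_twistEnd A B hB E hE q ?_ x
  rw [iotaZ_one_eq, ← ZHatLevel.levelChar_apply, hφ]

/-- (c4) on the `a`-chain: `α_{θ_u x} = α_x`. [cite: LyndonSchupp2001, Ch. II §3] -/
theorem alpha_twistEnd (A B : G) {n : ℕ} (hB : B ^ n = 1) (E : ℕ+) (hE : ∀ w : W G k, w ^ (E : ℕ) = 1) (q : ℕ)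
    {u : ZH} (hu : Multiplicative.toAdd (ZHatLevel.level E u) = ((1 + n * q : ℕ) : ZMod E)) (x : F₂hatT) :
    alpha (k := k) A B (twistEnd u x) = alpha A B x := by
  rw [alpha_def, fox_twistEnd A B hB E hE q hu, fst_left_torHom, ← alpha_def]

/-- (c4) on the `b`-chain: `β_{θ_u x} = β_x + q·Σ_{j<n} ρ_{B^j} β_x = β_x·(1 + q N_B)`. [cite: LyndonSchupp2001, Ch. II §3] -/
theorem beta_twistEnd (A B : G) {n : ℕ} (hB : B ^ n = 1) (E : ℕ+) (hE : ∀ w : W G k, w ^ (E : ℕ) = 1) (q : ℕ)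
    {u : ZH} (hu : Multiplicative.toAdd (ZHatLevel.level E u) = ((1 + n * q : ℕ) : ZMod E)) (x : F₂hatT) :
    beta (k := k) A B (twistEnd u x) = beta A B x + (q : k) • ∑ j ∈ Finset.range n, rt (B ^ j) (beta A B x) := by
  rw [beta_def, fox_twistEnd A B hB E hE q hu, snd_left_torHom, ← beta_def]

/-- (c4) on the level: `π (θ_u x) = π x`. [cite: LyndonSchupp2001, Ch. II §3] -/
theorem lev_twistEnd (A B : G) {n : ℕ} (hB : B ^ n = 1) (E : ℕ+) (hE : ∀ w : W G k, w ^ (E : ℕ) = 1) (q : ℕ)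
    {u : ZH} (hu : Multiplicative.toAdd (ZHatLevel.level E u) = ((1 + n * q : ℕ) : ZMod E)) (x : F₂hatT) :
    lev A B (twistEnd u x) = lev A B x := by
  rw [← fox_right (k := k), ← fox_right (k := k), fox_twistEnd A B hB E hE q hu, torHom_right]

/-- **(c4) for `u ≡ 1 (mod n)`** (the shape used by the torus law, row (Φ)): if `B^n = 1`, `0 < n` and `u ∈ Ẑ` has
`u ≡ 1 (mod n)`, then for SOME `q : ℕ`, `ψ ∘ θ_u = Tor_{B,n,q} ∘ ψ` (take `E = n·E₀` for an exponent `E₀` of `W`; then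
`u mod E = 1 + nq`). [cite: LyndonSchupp2001, Ch. II §3] -/
theorem exists_fox_twistEnd_eq_torHom (A B : G) {n : ℕ} (hn : 0 < n) (hB : B ^ n = 1) {u : ZH}
    (hu : Multiplicative.toAdd (ZHatLevel.level ⟨n, hn⟩ u) = 1) :
    ∃ q : ℕ, ∀ x : F₂hatT, fox (k := k) A B (twistEnd u x) = torHom B n (q : k) (fox A B x) := by
  obtain ⟨E₀, hE₀⟩ := exists_exponent (G := G) (k := k)
  haveI : NeZero ((⟨n, hn⟩ * E₀ : ℕ+) : ℕ) := ⟨PNat.ne_zero _⟩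
  have hE : ∀ w : W G k, w ^ ((⟨n, hn⟩ * E₀ : ℕ+) : ℕ) = 1 := fun w => by
    rw [PNat.mul_coe, PNat.mk_coe, mul_comm, pow_mul, hE₀, one_pow]
  -- `v := u mod nE₀` satisfies `v ≡ 1 (mod n)`
  set v : ℕ := (Multiplicative.toAdd (ZHatLevel.level (⟨n, hn⟩ * E₀) u)).val with hvdef
  have hv : v ≡ 1 [MOD n] := by
    have hc := ZHatLevel.cast_level_mul ⟨n, hn⟩ E₀ u
    rw [hu, ZMod.castHom_apply, ZMod.cast_eq_val] at hc
    rw [← ZMod.natCast_eq_natCast_iff, Nat.cast_one]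
    exact hc
  set N : ℕ := ((⟨n, hn⟩ * E₀ : ℕ+) : ℕ) with hNdef
  have hN : N = n * E₀ := by rw [hNdef, PNat.mul_coe, PNat.mk_coe]
  have h1 : 1 ≤ v + N := le_add_left NeZero.one_le
  have hdvd : n ∣ v + N - 1 := by
    refine (Nat.modEq_iff_dvd' h1).mp ?_
    have h2 : v + N ≡ 1 + 0 [MOD n] := hv.add (Nat.modEq_zero_iff_dvd.mpr ⟨E₀, hN⟩)
    rw [add_zero] at h2
    exact h2.symm
  refine ⟨(v + N - 1) / n, fun x => fox_twistEnd A B hB (⟨n, hn⟩ * E₀) hE ((v + N - 1) / n) ?_ x⟩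
  rw [Nat.mul_div_cancel' hdvd, Nat.add_sub_of_le h1, Nat.cast_add, ZMod.natCast_self, add_zero, hvdef,
    ZMod.natCast_zmod_val]

end Literature.AnabelianGeometry.EtaleTheta.SettingModel.FoxLevel

end
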